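import Summits.AnomalousDissipation.AnomalousDissipation.Theorems.SolenoidalFractalHomogenisationLagrangianStepD1TailBoundCore
import Summits.AnomalousDissipation.AnomalousDissipation.Theorems.SolenoidalFractalHomogenisationLagrangianStepSidebandMask
import Summits.AnomalousDissipation.AnomalousDissipation.Theorems.SolenoidalFractalHomogenisationLagrangianStepSidebandAdjacentDecay
import Summits.AnomalousDissipation.AnomalousDissipation.Theorems.SolenoidalFractalHomogenisationLagrangianStepSidebandXDefectSmall
import Summits.AnomalousDissipation.AnomalousDissipation.Theorems.SolenoidalFractalHomogenisationLagrangianStepD1TailStruct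
import HarnessLib

/-!
# K1L_D `stub_D1_residueTail` (registry v17, stmt-AnomalousDissipation-27980) — lane A4 `hbound`, CASE C: THE DIAGONAL — the own-slot fresh part is
# `excQS` exactly (κ = 1) and the wrap-around memory is `e^{−θmin}`-small (helper; `--supports stmt-AnomalousDissipation-27980`)

Summits-side helper file of route `SolenoidalFractalHomogenisation` (prover seat `ad-sawtooth-k1loc-p1` g13, lane A owner; case C of the tail certificate
`Lines/onelevel-D1-tail-cert.md` §3).  Everything proved; no definitions, no named facts, no sorry.
* **`tail_bound_of_decomp`** — the common end game of every case: if `(ν/4π²)Re⟪pC, M_{jj'}qC⟫ − Re⟪pC, cmat(freshMat)qC⟫ = (ν/4π²)Re⟪pC, (1/P₁)•∫_{slot j} X⟫`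
  and `‖⟪pC, X t⟫‖ ≤ (1/(2|mⱼ|))·‖Pⱼ pC‖·2·e^{−θmin}·(8π‖α_{j'}‖/r)·‖P_{j'} qC‖` on the slot, then `|tailKernel| ≤ gTail j j'·√PpSq_j(p)·√PpSq_{j'}(q)` (`tail_arith`);
* `norm_responseExt_le_of_gap` — the state of slot `j'` at a time `b` preceded by a source-free stretch of length `≥ τ¹_{i₀}` is `≤ e^{−θmin}·(8π‖α_{j'}‖/r)‖P_{j'} qC‖`;
* `freshMat_diag` — `freshMat S j j = slotCoefⱼ • slotQⱼ`;
* **`tail_bound_caseC`** — the diagonal: `meanFeedback_diag_apply` (p696263; the fresh part cancels `excQS` EXACTLY) + the wrap term read through the pickup bound with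
  the state at `startⱼ`, which has not been forced since `endⱼ − P₁` (`P₁ − τ¹ⱼ ≥ τ¹_{i₀}`).
NOT a proof of the registered stub, of the crux, or of anomalous dissipation; rung leaf F-D1 infrastructure.
-/

set_option linter.dupNamespace false

noncomputable section

namespace Summit.AnomalousDissipation.AnomalousDissipation.Theorems.SolenoidalFractalHomogenisation.LagrangianStep.D1Tail

open Summit.AnomalousDissipation.AnomalousDissipation.Theorems
open Summit.AnomalousDissipation.AnomalousDissipation.Theorems.SolenoidalFractalHomogenisation.LagrangianStep
open Summit.AnomalousDissipation.AnomalousDissipation.Theorems.SolenoidalFractalHomogenisation.LagrangianStep.WCrossing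
open Summit.AnomalousDissipation.AnomalousDissipation.Theorems.SolenoidalFractalHomogenisation.LagrangianStep.D1ResidueCert
open Summit.AnomalousDissipation.AnomalousDissipation.Theorems.SolenoidalFractalHomogenisation.LagrangianStep.D1TailCert
open Summit.AnomalousDissipation.AnomalousDissipation.Theorems.SolenoidalFractalHomogenisation.LagrangianStep.Sideband
open Summit.AnomalousDissipation.AnomalousDissipation.Theorems.SolenoidalFractalHomogenisation.LagrangianStep.CellChain (start_stretch_stretch)
open Summit.AnomalousDissipation.AnomalousDissipation.Theorems.SolenoidalFractalHomogenisation.PermissibleCarrier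
  (period_pos start_nonneg start_add_tau_le_period)
open Summit.AnomalousDissipation.AnomalousDissipation.Theorems.SolenoidalFractalHomogenisation.RealisedQuasiStaticCellLaw (start_add_tau_le_start)
open Literature.Analysis Literature.Analysis.FluidPDE Literature.Analysis.FunctionSpaces Literature.Analysis.FunctionSpaces.Torus
open Literature.Analysis.FluidPDE.Torus Literature.Analysis.FluidPDE.LatticeShear
open Set Real Complex MeasureTheory intervalIntegral
open scoped InnerProductSpace

/-! ## §1 The common end game -/

/-- **FROM A DECOMPOSITION OF `M_{jj'} qC` TO THE PER-PAIR BOUND.**  `ν ∈ (0, 1/40]`, `W₁ = (cubatureWord.stretch MB).stretch (1/ν)`,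
`r = min 1 (4π²ν(10/11))`, `pC = (p : ℂ³)`, `qC = (q : ℂ³)`.  If the fresh part cancels,
`(ν/4π²)·Re⟪pC, M_{jj'} qC⟫ − Re⟪pC, cmat(freshMat S j j') qC⟫ = (ν/4π²)·Re⟪pC, (1/P₁) • ∫_{startⱼ}^{startⱼ+τ¹ⱼ} X⟫`, and on the slot
`‖⟪pC, X t⟫‖ ≤ (1/(2|mⱼ|))·‖Pⱼ pC‖·(2·(e^{−θmin}·((8π‖α_{j'}‖/r)·‖P_{j'} qC‖)))`, then `|tailKernel ν S p q j j'| ≤ gTail j j'·(√PpSq_j(p)·√PpSq_{j'}(q))`.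
[cite: ArmstrongVicol2025, §3 (renormalised diffusivity of one level)] -/
theorem tail_bound_of_decomp {ν : ℝ} (hν : ν ∈ Ioc (0:ℝ) (1 / 40)) (S : T4) (p q : Fin 3 → ℝ) (j j' : Fin 26)
    (X : ℝ → EuclideanSpace ℂ (Fin 3))
    (hXint : IntervalIntegrable X volume (((cubatureWord.stretch MB MB_pos).stretch (1 / ν) (one_div_pos.mpr hν.1)).start j)
      (((cubatureWord.stretch MB MB_pos).stretch (1 / ν) (one_div_pos.mpr hν.1)).start j +
        (((cubatureWord.stretch MB MB_pos).stretch (1 / ν) (one_div_pos.mpr hν.1)).phase j).τ))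
    (hM : ν / (4 * π ^ 2) * (⟪(WithLp.toLp 2 fun i => ((p i : ℝ) : ℂ) : EuclideanSpace ℂ (Fin 3)),
        meanFeedback ((cubatureWord.stretch MB MB_pos).stretch (1 / ν) (one_div_pos.mpr hν.1)) (ν • S) 1 (R0 ν) j j'
          (WithLp.toLp 2 fun i => ((q i : ℝ) : ℂ))⟫_ℂ).re -
      (⟪(WithLp.toLp 2 fun i => ((p i : ℝ) : ℂ) : EuclideanSpace ℂ (Fin 3)),
        Matrix.toEuclideanCLM (n := Fin 3) (𝕜 := ℂ) ((freshMat S j j').map ((↑) : ℝ → ℂ)) (WithLp.toLp 2 fun i => ((q i : ℝ) : ℂ))⟫_ℂ).re =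
      ν / (4 * π ^ 2) * (⟪(WithLp.toLp 2 fun i => ((p i : ℝ) : ℂ) : EuclideanSpace ℂ (Fin 3)),
        (1 / ((cubatureWord.stretch MB MB_pos).stretch (1 / ν) (one_div_pos.mpr hν.1)).period) •
          ∫ t in ((cubatureWord.stretch MB MB_pos).stretch (1 / ν) (one_div_pos.mpr hν.1)).start j..((cubatureWord.stretch MB MB_pos).stretch
            (1 / ν) (one_div_pos.mpr hν.1)).start j + (((cubatureWord.stretch MB MB_pos).stretch (1 / ν) (one_div_pos.mpr hν.1)).phase j).τ, X t⟫_ℂ).re)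
    (hpt : ∀ t ∈ Set.uIoc (((cubatureWord.stretch MB MB_pos).stretch (1 / ν) (one_div_pos.mpr hν.1)).start j)
      (((cubatureWord.stretch MB MB_pos).stretch (1 / ν) (one_div_pos.mpr hν.1)).start j +
        (((cubatureWord.stretch MB MB_pos).stretch (1 / ν) (one_div_pos.mpr hν.1)).phase j).τ),
      ‖⟪(WithLp.toLp 2 fun i => ((p i : ℝ) : ℂ) : EuclideanSpace ℂ (Fin 3)), X t⟫_ℂ‖ ≤
        1 / (2 * ‖latticeVec (cubatureWord.phase j).m‖) * ‖transversalProj (cubatureWord.phase j).m (WithLp.toLp 2 fun i => ((p i : ℝ) : ℂ) : EuclideanSpace ℂ (Fin 3))‖ *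
          (2 * (Real.exp (-θmin) * (8 * π * ‖slotAmp ((cubatureWord.stretch MB MB_pos).stretch (1 / ν) (one_div_pos.mpr hν.1)) j'‖ /
            min (1:ℝ) (4 * π ^ 2 * (ν * (10 / 11))) * ‖transversalProj (cubatureWord.phase j').m (WithLp.toLp 2 fun i => ((q i : ℝ) : ℂ) : EuclideanSpace ℂ (Fin 3))‖)))) :
    |tailKernel ν S p q j j'| ≤ gTail j j' * (Real.sqrt (PpSq j p) * Real.sqrt (PpSq j' q)) := by
  obtain ⟨hν0, hν40⟩ := hν
  set W₁ := (cubatureWord.stretch MB MB_pos).stretch (1 / ν) (one_div_pos.mpr hν0) with hW₁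
  set pC : EuclideanSpace ℂ (Fin 3) := WithLp.toLp 2 fun i => ((p i : ℝ) : ℂ) with hpC
  set qC : EuclideanSpace ℂ (Fin 3) := WithLp.toLp 2 fun i => ((q i : ℝ) : ℂ) with hqC
  set s := W₁.start j with hs
  set L := (W₁.phase j).τ with hL
  have hLpos : 0 < L := (W₁.phase j).τ_pos
  set C : ℝ := 1 / (2 * ‖latticeVec (cubatureWord.phase j).m‖) * ‖transversalProj (cubatureWord.phase j).m pC‖ *
    (2 * (Real.exp (-θmin) * (8 * π * ‖slotAmp W₁ j'‖ / min (1:ℝ) (4 * π ^ 2 * (ν * (10 / 11))) * ‖transversalProj (cubatureWord.phase j').m qC‖)))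
    with hC
  have hinner : ‖⟪pC, ∫ t in s..s + L, X t⟫_ℂ‖ ≤ C * |s + L - s| := norm_inner_integral_le_of_le hXint pC hpt
  rw [show s + L - s = L by ring, abs_of_pos hLpos] at hinner
  rw [tailKernel_eq_re_inner hν0, hM, ← Complex.coe_smul, inner_smul_right, Complex.re_ofReal_mul]
  have hP0 : 0 < W₁.period := period_pos W₁
  have hν' : 0 ≤ ν / (4 * π ^ 2) := by positivity
  calc |ν / (4 * π ^ 2) * (1 / W₁.period * (⟪pC, ∫ t in s..s + L, X t⟫_ℂ).re)|
      = ν / (4 * π ^ 2) * (1 / W₁.period * |(⟪pC, ∫ t in s..s + L, X t⟫_ℂ).re|) := by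
        rw [abs_mul, abs_mul, abs_of_nonneg hν', abs_of_pos (by positivity : (0:ℝ) < 1 / W₁.period)]
    _ ≤ ν / (4 * π ^ 2) * (1 / W₁.period * (C * L)) :=
        mul_le_mul_of_nonneg_left (mul_le_mul_of_nonneg_left ((Complex.abs_re_le_norm _).trans hinner) (by positivity)) hν'
    _ = gTail j j' * (Real.sqrt (PpSq j p) * Real.sqrt (PpSq j' q)) := by
        rw [hC, ← norm_transversalProj_realVec j p, ← norm_transversalProj_realVec j' q, ← hpC, ← hqC]
        have h := tail_arith hν0 hν40 j j' ‖transversalProj (cubatureWord.phase j).m pC‖ ‖transversalProj (cubatureWord.phase j').m qC‖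
        simp only at h
        rw [← hW₁] at h
        rw [← h, hL]

/-- **The state after a source-free stretch of at least one full slot**: if the envelope of slot `j'` vanishes on `[a, b)`, `a ≤ b` and
`τ¹_{i₀} ≤ b − a`, then `‖N̄_{j'}(b) v‖ ≤ e^{−θmin}·((8π‖α_{j'}‖/r)·‖P_{j'} v‖)`. [cite: SandersVerhulstMurdock2007, Lemma 5.2.7 (linear case)] -/
theorem norm_responseExt_le_of_gap {ν : ℝ} (hν : ν ∈ Ioc (0:ℝ) (1 / 40)) {S : T4} (hS : Torus.NearIso S (10 / 11) (11 / 10)) (j' i₀ : Fin 26)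
    (v : EuclideanSpace ℂ (Fin 3)) {a b : ℝ} (hab : a ≤ b)
    (hgap : (((cubatureWord.stretch MB MB_pos).stretch (1 / ν) (one_div_pos.mpr hν.1)).phase i₀).τ ≤ b - a)
    (henv : ∀ u ∈ Ico a b, slotEnvelope ((cubatureWord.stretch MB MB_pos).stretch (1 / ν) (one_div_pos.mpr hν.1)) j' u = 0) :
    ‖responseExt ((cubatureWord.stretch MB MB_pos).stretch (1 / ν) (one_div_pos.mpr hν.1)) (ν • S) 1 (R0 ν) j' b v‖ ≤
      Real.exp (-θmin) * (8 * π * ‖slotAmp ((cubatureWord.stretch MB MB_pos).stretch (1 / ν) (one_div_pos.mpr hν.1)) j'‖ /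
        min (1:ℝ) (4 * π ^ 2 * (ν * (10 / 11))) * ‖transversalProj (cubatureWord.phase j').m v‖) := by
  obtain ⟨hν0, hν40⟩ := hν
  set W₁ := (cubatureWord.stretch MB MB_pos).stretch (1 / ν) (one_div_pos.mpr hν0) with hW₁
  have h𝔸 : Torus.NearIso (ν • S) (ν * (10 / 11)) (ν * (11 / 10)) := hS.smul hν0.le
  have hlo : 0 < ν * (10 / 11) := by positivity
  set r := min (1:ℝ) (4 * π ^ 2 * (ν * (10 / 11))) with hr
  have hr0 : 0 ≤ r := le_min zero_le_one (by positivity)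
  have hrmin : r = 4 * π ^ 2 * (ν * (10 / 11)) := min_one_viscRate ⟨hν0, hν40⟩
  have hNj' := isPeriodicResponse_cubature hν0 hS j'
  have hdec := norm_responseExt_le_exp_of_envelope_zero W₁ h𝔸 hlo.le 1 (R0 ν) j' hNj' v hab henv
  have hsup : ‖responseExt W₁ (ν • S) 1 (R0 ν) j' a v‖ ≤
      8 * π * ‖slotAmp W₁ j'‖ / r * ‖transversalProj (cubatureWord.phase j').m v‖ := norm_responseExt_apply_le W₁ h𝔸 hlo one_pos (R0 ν) j' a v
  have hθ : Real.exp (-(r * (b - a))) ≤ Real.exp (-θmin) := by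
    refine (Real.exp_le_exp.mpr ?_).trans (exp_neg_θs_le i₀)
    have h2 : r * (W₁.phase i₀).τ = θs i₀ := by rw [hrmin, hW₁, tau_stretch_stretch cubatureWord MB_pos hν0 i₀]; exact viscRate_mul_slotLen hν0 i₀
    nlinarith [mul_le_mul_of_nonneg_left hgap hr0]
  calc ‖responseExt W₁ (ν • S) 1 (R0 ν) j' b v‖ ≤ Real.exp (-(r * (b - a))) * ‖responseExt W₁ (ν • S) 1 (R0 ν) j' a v‖ := hdec
    _ ≤ Real.exp (-θmin) * (8 * π * ‖slotAmp W₁ j'‖ / r * ‖transversalProj (cubatureWord.phase j').m v‖) :=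
        mul_le_mul hθ hsup (norm_nonneg _) (Real.exp_pos _).le

/-! ## §2 Case C: the diagonal -/

/-- `freshMat S j j = slotCoefⱼ • slotQⱼ`. [cite: ArmstrongVicol2025, §3] -/
theorem freshMat_diag (S : T4) (j : Fin 26) : freshMat S j j = slotCoef cubatureWord j • slotQ cubatureWord MB S j := by
  rw [freshMat_def, if_pos rfl, Finset.sum_eq_zero, add_zero]
  intro l _
  rw [if_neg]
  rintro ⟨h1, h2⟩
  exact sndSlot_ne_fstSlot l l (h1.symm.trans h2)

set_option maxHeartbeats 400000 in
/-- **CASE C** (diagonal): `|tailKernel ν S p q j j| ≤ gTail j j · (√PpSq_j(p) · √PpSq_j(q))`. [cite: ArmstrongVicol2025, §3]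
[cite: MajdaKramer1999, §2.2.1.3 (55)] [cite: SandersVerhulstMurdock2007, Lemma 5.2.7] -/
theorem tail_bound_caseC {ν : ℝ} (hν : ν ∈ Ioc (0:ℝ) (1 / 40)) {S : T4} (hS : Torus.NearIso S (10 / 11) (11 / 10)) (p q : Fin 3 → ℝ)
    (j : Fin 26) : |tailKernel ν S p q j j| ≤ gTail j j * (Real.sqrt (PpSq j p) * Real.sqrt (PpSq j q)) := by
  have hν' := hν
  obtain ⟨hν0, hν40⟩ := hν'
  have hν1 : ν ≤ 1 := by linarith
  set W₁ := (cubatureWord.stretch MB MB_pos).stretch (1 / ν) (one_div_pos.mpr hν0) with hW₁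
  have h𝔸 : Torus.NearIso (ν • S) (ν * (10 / 11)) (ν * (11 / 10)) := hS.smul hν0.le
  have hlo : 0 < ν * (10 / 11) := by positivity
  set r := min (1:ℝ) (4 * π ^ 2 * (ν * (10 / 11))) with hr
  have hr0 : 0 ≤ r := le_min zero_le_one (by positivity)
  have hNj := isPeriodicResponse_cubature hν0 hS j
  have hm := mem_box_cubature hν0 hν1 j
  have hm' := neg_mem_box_cubature hν0 hν1 j
  set N := response W₁ (ν • S) 1 (R0 ν) j with hNdef
  set pC : EuclideanSpace ℂ (Fin 3) := WithLp.toLp 2 fun i => ((p i : ℝ) : ℂ) with hpC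
  set qC : EuclideanSpace ℂ (Fin 3) := WithLp.toLp 2 fun i => ((q i : ℝ) : ℂ) with hqC
  set s := W₁.start j with hs
  set L := (W₁.phase j).τ with hL
  have hLpos : 0 < L := (W₁.phase j).τ_pos
  have hs0 : 0 ≤ s := start_nonneg W₁ j
  have hsP : s + L ≤ W₁.period := start_add_tau_le_period W₁ j
  set Bℝ := (blockGen (ν • S) 1 (W₁.phase j).m).restrictScalars ℝ with hB
  set xm := coordL (R0 ν) (-(W₁.phase j).m) (N s qC) with hxm
  set xp := coordL (R0 ν) (W₁.phase j).m (N s qC) with hxp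
  have hxm_le : ‖xm‖ ≤ ‖N s qC‖ := by rw [hxm]; exact norm_coordL_le _ _
  have hxp_le : ‖xp‖ ≤ ‖N s qC‖ := by rw [hxp]; exact norm_coordL_le _ _
  -- the wrap integrand
  obtain ⟨X, hX⟩ : ∃ X : ℝ → EuclideanSpace ℂ (Fin 3), X = fun t =>
      (2 * Real.pi * Complex.I * ((slotEnvelope W₁ j t : ℝ) : ℂ)) • (slotAmp W₁ j • NormedSpace.exp ((t - s) • Bℝ) xm + starRingEnd ℂ (slotAmp W₁ j) • NormedSpace.exp ((t - s) • Bℝ) xp) :=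
    ⟨_, rfl⟩
  have hEc : Continuous fun u : ℝ => NormedSpace.exp (u • Bℝ) := continuous_iff_continuousAt.2 fun u => (hasDerivAt_exp_smul_const Bℝ u).continuousAt
  have hXc : Continuous X := by
    rw [hX]
    refine (continuous_const.mul (Complex.continuous_ofReal.comp (continuous_slotEnvelope W₁ j))).smul ?_
    exact ((((hEc.comp (continuous_id.sub continuous_const)).clm_apply continuous_const).const_smul (slotAmp W₁ j)).add
      (((hEc.comp (continuous_id.sub continuous_const)).clm_apply continuous_const).const_smul (starRingEnd ℂ (slotAmp W₁ j))))
  -- the state at the slot start: not forced since the end of the slot one period earlier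
  set SUP : ℝ := 8 * π * ‖slotAmp W₁ j‖ / r * ‖transversalProj (cubatureWord.phase j).m qC‖ with hSUP
  have hstate : ‖N s qC‖ ≤ Real.exp (-θmin) * SUP := by
    have hsExt : N s qC = responseExt W₁ (ν • S) 1 (R0 ν) j s qC := by
      rw [hNdef, responseExt_of_mem_Ico W₁ (ν • S) 1 (R0 ν) j ⟨hs0, by linarith⟩]
    rw [hsExt]
    -- gap slot: `0` if `j ≠ 0`, `1` if `j = 0`
    have hgap : ∃ i₀ : Fin 26, (W₁.phase i₀).τ ≤ s - (s + L - W₁.period) := by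
      by_cases hj0 : j.val = 0
      · have hlt : j < (1 : Fin 26) := by rw [Fin.lt_def]; simp [hj0]
        refine ⟨1, ?_⟩
        have h1 := start_add_tau_le_start W₁ hlt
        have h2 := start_add_tau_le_period W₁ (1 : Fin 26)
        linarith
      · have hlt : (0 : Fin 26) < j := by rw [Fin.lt_def, Fin.val_zero]; omega
        refine ⟨0, ?_⟩
        have h1 := start_add_tau_le_start W₁ hlt
        have h0 : W₁.start 0 = 0 := by
          unfold LatticeWord.start; exact Finset.sum_eq_zero fun i hi => by simp at hi
        rw [h0, zero_add] at h1
        linarith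
    obtain ⟨i₀, hi₀⟩ := hgap
    refine norm_responseExt_le_of_gap hν hS j i₀ qC (by linarith) hi₀ ?_
    intro u hu
    show slotEnvelope W₁ j u = 0
    by_cases hu0 : u < 0
    · have h := slotEnvelope_add_int_mul_period W₁ j (u + W₁.period) (-1)
      rw [show u + W₁.period + ((-1 : ℤ) : ℝ) * W₁.period = u by push_cast; ring] at h
      rw [h]
      exact slotEnvelope_eq_zero_of_end_le W₁ j (by linarith [hu.1]) (by linarith)
    · exact slotEnvelope_eq_zero_of_le_start W₁ j (not_lt.mp hu0) hu.2.le
  have hSUP0 : 0 ≤ SUP := by rw [hSUP]; positivity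
  -- transversality of the old amplitudes and of their images under the own-slot semigroup
  have hsP' : s ∈ Icc 0 W₁.period := ⟨hs0, by linarith⟩
  have hxmt : transversalProj (W₁.phase j).m xm = xm := transversalProj_coordL_response W₁ h𝔸 hlo one_pos (R := R0 ν) j hsP' qC _ _ (Or.inr rfl)
  have hxpt : transversalProj (W₁.phase j).m xp = xp := transversalProj_coordL_response W₁ h𝔸 hlo one_pos (R := R0 ν) j hsP' qC _ _ (Or.inl rfl)
  have hEt : ∀ (τ : ℝ) (x : EuclideanSpace ℂ (Fin 3)), transversalProj (W₁.phase j).m x = x →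
      transversalProj (W₁.phase j).m (NormedSpace.exp (τ • Bℝ) x) = NormedSpace.exp (τ • Bℝ) x := by
    intro τ x hx
    have h : transversalProj (W₁.phase j).m (NormedSpace.exp (τ • Bℝ) (transversalProj (W₁.phase j).m x)) = NormedSpace.exp (τ • Bℝ) (transversalProj (W₁.phase j).m x) :=
      transversalProj_exp_blockGen_transversalProj S ν 1 (W₁.phase j) τ x
    simpa only [hx] using h
  have hmne : (W₁.phase j).m ≠ 0 := (W₁.phase j).m_ne
  -- pointwise bound of the wrap pairing
  have hpt : ∀ t ∈ Set.uIoc s (s + L), ‖⟪pC, X t⟫_ℂ‖ ≤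
      1 / (2 * ‖latticeVec (cubatureWord.phase j).m‖) * ‖transversalProj (cubatureWord.phase j).m pC‖ * (2 * (Real.exp (-θmin) * SUP)) := by
    intro t ht
    rw [Set.uIoc_of_le (by linarith)] at ht
    rw [hX]
    have hpick := norm_inner_pickup_le W₁ j t pC (hEt (t - s) xm hxmt) (hEt (t - s) xp hxpt)
    have hτ : 0 ≤ t - s := by linarith [ht.1]
    have h1 : Real.exp (-(r * (t - s))) ≤ 1 := by
      rw [Real.exp_le_one_iff]
      have := mul_nonneg hr0 hτ
      linarith
    have hEm : ‖NormedSpace.exp ((t - s) • Bℝ) xm‖ ≤ Real.exp (-θmin) * SUP :=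
      (norm_exp_blockGen_le h𝔸 hlo.le 1 hmne xm hτ).trans ((mul_le_of_le_one_left (norm_nonneg _) h1).trans (hxm_le.trans hstate))
    have hEp : ‖NormedSpace.exp ((t - s) • Bℝ) xp‖ ≤ Real.exp (-θmin) * SUP :=
      (norm_exp_blockGen_le h𝔸 hlo.le 1 hmne xp hτ).trans ((mul_le_of_le_one_left (norm_nonneg _) h1).trans (hxp_le.trans hstate))
    have h0 : 0 ≤ 1 / (2 * ‖latticeVec (W₁.phase j).m‖) * ‖transversalProj (W₁.phase j).m pC‖ := by positivity
    calc ‖⟪pC, (2 * Real.pi * Complex.I * ((slotEnvelope W₁ j t : ℝ) : ℂ)) •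
          (slotAmp W₁ j • NormedSpace.exp ((t - s) • Bℝ) xm + starRingEnd ℂ (slotAmp W₁ j) • NormedSpace.exp ((t - s) • Bℝ) xp)⟫_ℂ‖
        ≤ 1 / (2 * ‖latticeVec (W₁.phase j).m‖) * ‖transversalProj (W₁.phase j).m pC‖ * (‖NormedSpace.exp ((t - s) • Bℝ) xm‖ + ‖NormedSpace.exp ((t - s) • Bℝ) xp‖) :=
          hpick
      _ ≤ 1 / (2 * ‖latticeVec (W₁.phase j).m‖) * ‖transversalProj (W₁.phase j).m pC‖ * (2 * (Real.exp (-θmin) * SUP)) :=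
          mul_le_mul_of_nonneg_left (by linarith) h0
      _ = _ := rfl
  -- the decomposition: the fresh part is `excQS` exactly
  have hdiag := meanFeedback_diag_apply cubatureWord MB_pos hν0 hS (by norm_num : (0:ℝ) < 10 / 11) j hm hm' qC
  simp only at hdiag
  rw [← hW₁] at hdiag
  have hM : ν / (4 * π ^ 2) * (⟪pC, meanFeedback W₁ (ν • S) 1 (R0 ν) j j qC⟫_ℂ).re -
      (⟪pC, Matrix.toEuclideanCLM (n := Fin 3) (𝕜 := ℂ) ((freshMat S j j).map ((↑) : ℝ → ℂ)) qC⟫_ℂ).re =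
      ν / (4 * π ^ 2) * (⟪pC, (1 / W₁.period) • ∫ t in s..s + L, X t⟫_ℂ).re := by
    rw [hdiag, freshMat_diag, cmat_smul, inner_add_right, Complex.add_re, mul_add, inner_smul_right, Complex.re_ofReal_mul,
      _root_.smul_apply, inner_smul_right, Complex.re_ofReal_mul, hX]
    have hπ : π ≠ 0 := Real.pi_pos.ne'
    field_simp
    ring
  exact tail_bound_of_decomp hν S p q j j X (hXc.intervalIntegrable _ _) hM hpt

end Summit.AnomalousDissipation.AnomalousDissipation.Theorems.SolenoidalFractalHomogenisation.LagrangianStep.D1Tail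

end
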